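/-
Copyright: cell `pub-ymgap` (HUMAN RULING D-0062), Track A of `YM-PLAN.md`, DAG node N20 (= NE7b); R134 acceleration seat
`pub-ymgap-dag-n20-c` (strategy s1, generation 4), module 24.  Released under the licence of the surrounding project.
-/
import Summits.QuantumFields.YangMills.Theorems.BalabanUVNodesN20LCSLargeFieldSubfamilies
import Summits.QuantumFields.YangMills.Theorems.BalabanUVNodesN20ChiSemantics
import HarnessLib

/-!
# YM-DAG node N20 (= NE7b), strategy s1, module 24: KEYS ROOTED AT THE FIRST STEP ARE SERVED AT EVERY CUTOFF — `PointwiseExtraction ∧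
# LocCondStability` for ALL `K`, extracting at level 0 and booking the later levels free (`a ≤ 0 ≤ b`, `M = 1`), for label-reading towers

Track A of `YM-PLAN.md` (cell `pub-ymgap`, HUMAN RULING D-0062), node **N20** = spine estimate NE7b (`T4WeightBudget.RelWeightBound` — NOT PRINTED,
NOT PROVED).  Seat `pub-ymgap-dag-n20-c` (R134, s1), generation 4, module 24 (17–23 = `…N20LCSLargeField{Labels,FirstStep,Families,Halves,OfMoments,
Subfamilies}`, `…N20LCSLabelPieces`).  Kernel theorems only: 0 `def`, 0 `sorry`, standard axioms; COUNT-NEUTRAL; `--supports` the K3‴ item.  Nothing of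
Bałaban's is asserted.

WHY.  The (α)-road books, per bad key, the two named `Prop`s at a cutoff `K` along the whole key pattern (`pwA`∕`lcsA` of
`Support/B16HistoryTowerExtractionStepDataLWR`), the count being the cost–volume sum `Σ_{j<K}(a − b)` (`sum_admS_integral_le_of_LCS`); its design clause
allows `a = b = 0` (carrier `1`) at the levels where nothing is extracted (`LocalConditionalStability.unpinned_extraction ∕ unpinned_stability`).  Modules 20
and 23 inhabited both `Prop`s at cutoff `1`.  THIS FILE inhabits them AT EVERY CUTOFF for a key ROOTED AT THE FIRST STEP: extraction at level `0`
(modules 19∕23's indicator carrier) and the free booking at the levels `j ≥ 1`, where a label-reading kernel sum is at most `1` because the label weights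
of record are a non-negative decomposition of unity:
* §1 `sum_ωOfRecord_sub_le_one` — modulo `IsZetaUnity` and the displayed positivity `0 ≤ ζ`, every sub-sum of the label weights at any step is
  `≤ e^{−0}·1` (module 21's `sum_ωOfRecord_eq_one` + module 23's `ωOfRecord_nonneg`);
* §2 ★★★ **`halves_of_record_rootedAtZero`** — for EVERY cutoff `Kc`, every history tower `T` over `cfgOfRecord F N K ·`, every pattern, every
  level measures with `μ 0 = ∏dU`, every step-kernel family that READS LABEL SUB-SUMS of the record at every level (`hread`; the level-`0` sets pinning
  `D`), the carrier family `M 0 h = e^{a 0 h}·𝟙_{event}`, `M j h = 1` (`j ≥ 1`), exponents with `e^{a 0 h}·(m·e^{Cδ₀ − δ₀g₀⁻²ε″²∕(2N)})^{#D} ≤ e^{b 0 h}`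
  and `a j h ≤ 0 ≤ b j h` (`j ≥ 1`), and the (α)-road's own displayed rows `hint` (integrability of the history terms) and `hρ₀` (`ρ₀` in the good
  class, whence `eterm ≥ 0` by `Tower.eterm_nonneg`):  `PointwiseExtraction T S Kc χ M a ∧ LocCondStability T S Kc μ (rhoZeroOfRecord F N K g₀ E₀) M b`.
  So along a key pattern ROOTED AT STEP 0 the available cost–volume sum is `(a − b)(0) + Σ_{1≤j<Kc}(a − b)(j)` with
  `(a − b)(0) = #D·(δ₀g₀⁻²ε″²∕(2N) − Cδ₀ − log m)` and the free levels bookable at `a = b = 0`.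
* §3 SANITY (A3 witness, NOT Bałaban's regime): `chiFactor_eq_one_of_epsreg_le` ∕ `hreg_of_epsreg_le` — when the test threshold dominates the
  regularity threshold (`εreg ≤ ε_{k+1}`) the (3.2) factor is identically `1` (n20-d's `plaqSmall_ukBox_of_solvable` ∕ the typing convention), so the
  displayed regularity letter is satisfiable at the objects of record.

HONEST FRAMING.  For keys rooted at a step `j₀ ≥ 1` the extraction at `j₀` needs «LCS-j₀» in the dressed state (module 22's hypothesis; (A1c)) —
NOT here; three displayed letters (`IsZetaUnity`, `IsZetaAbsLeOne`, `0 ≤ ζ`) plus the per-cube regularity letters; label-reading kernels (`hread`) and the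
identification «the key pattern's labels pin the key's cells» are the instance's; the tower OBJECT is not built.  NE7b NOT PRINTED ∕ NOT PROVED;
(α)-instance 0∕1; N20 NOT discharged; typed 28∕28, discharged count untouched; one finite four-torus at fixed `ε` — NOT ℝ⁴, NOT infinite volume, NOT OS,
NOT a mass gap, NOT Clay.

References: T. Bałaban, CMP 119 (1988) 243–285 [Balaban1988Convergent] ((3.2) p. 265, (2.12) p. 256, (2.16)–(2.17) p. 257); CMP 122 (1989) 175–202
[Balaban1989LargeFieldI] ((0.1) p. 175, (1.22)–(1.28) pp. 181–183); CMP 122 (1989) 355–392 [Balaban1989LargeFieldII] ((1.79)–(1.80) pp. 383–384);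
CMP 102 (1985) 277–309 [Balaban1985Variational] (Thm 1 p. 279).
-/

set_option autoImplicit false

noncomputable section

open scoped BigOperators

namespace Summit.QuantumFields.YangMills.BalabanUVNodes.N20LCSLargeFieldRootedAtZero

open MeasureTheory
open Literature.MathematicalPhysics.QuantumFieldTheory.Balaban1983to89
open Literature.MathematicalPhysics.QuantumFieldTheory.Balaban1983to89.T4Continuum
open Literature.MathematicalPhysics.QuantumFieldTheory.Balaban1983to89.Node00
open Summit.QuantumFields.BalabanUV.T4Continuum.B16HistoryIndexedRepr (GoodClass)
open Summit.QuantumFields.BalabanUV.T4Continuum.B16HistoryReprChain (Tower)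
open Summit.QuantumFields.BalabanUV.T4Continuum.NE7b.PrefixExtraction (admS)
open Summit.QuantumFields.BalabanUV.T4Continuum.NE7b.LocalConditionalStability (LocCondStability PointwiseExtraction)
open Summit.QuantumFields.YangMills.BalabanUVNodes.N20LCSLabelPieces (sum_ωOfRecord_eq_one)
open Summit.QuantumFields.YangMills.BalabanUVNodes.N20LCSLargeFieldHalves (integral_exp_mul_indicator_rhoZero_le)
open Summit.QuantumFields.YangMills.BalabanUVNodes.N20LCSLargeFieldSubfamilies
  (ωOfRecord_nonneg abs_sum_ωOfRecord_sub_le_indicator)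
open B15DeterminingSets (IsMinimizer avgFamily)
open B14.Eq213DetSet (Bj)
open Literature.MathematicalPhysics.QuantumFieldTheory.BalabanImbrieJaffe1984to88.BIJ85Eq453GaugeField (qsstarGIter0)
open Summit.QuantumFields.YangMills.BalabanUVNodes.N20ChiSemantics (plaqSmall_ukBox_of_solvable chiSmall_ukBox_eq_one_of_not_solvable)

variable (F : T4Family) (N : ℕ) [NeZero N] (ν : Stage7Numerics) (M : ℕ) (p : B12.RunParams) (g : ℕ → ℝ)

/-! ## §1 A free level: a sub-sum of the label weights is at most one -/

/-- **AT A FREE LEVEL NOTHING IS EXTRACTED AND NOTHING IS SACRIFICED** (label-indexed form of `LocalConditionalStability.unpinned_extraction`): modulo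
`IsZetaUnity` and `0 ≤ ζ`, every sub-sum of the label weights of record is at most `e^{−0}·1`. [folklore] -/
theorem sum_ωOfRecord_sub_le_one (k : ℕ) (A₁ : ℝ) {ζ : ZetaOfRecord F N ν M} (hζu : IsZetaUnity F N ν M ζ)
    (hζ0 : ∀ q g' k' (s : SeqOfRecord F ν M g' q.K k') Pl Ql RS U V', 0 ≤ ζ q g' k' s Pl Ql RS U V')
    (s : SeqOfRecord F ν M g p.K k) (E : Finset (LbOfRecord F ν p g k))
    (U : GaugeField (F.P p.K) k (SU N)) (V' : GaugeField (F.P p.K) (k + 1) (SU N)) :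
    ∑ t ∈ E, ωOfRecord F N ν M p g k A₁ ζ s t U V' ≤ Real.exp (-0) * 1 := by
  classical
  rw [neg_zero, Real.exp_zero, one_mul, ← sum_ωOfRecord_eq_one F N ν M p g k A₁ hζu s U V']
  exact Finset.sum_le_sum_of_subset_of_nonneg (Finset.subset_univ E) fun t _ _ => ωOfRecord_nonneg F N ν M p g k A₁ hζ0 s t U V'

/-! ## §2 Both named `Prop`s at every cutoff for a key rooted at the first step -/

/-- **KEYS ROOTED AT THE FIRST STEP ARE SERVED AT EVERY CUTOFF.**  With the `δ₀ > 0`, `C ≥ 0` of n20-d's cells Peierls bound: on every torus `F.P K`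
(`K ≥ 1`), for `g₀⁻² ≥ 4N`, every `E₀`, every residual fluctuation factor obeying `IsZetaUnity`, `IsZetaAbsLeOne` AND `0 ≤ ζ` (displayed), every `A₁`,
every level-`0` sequence `s`, every finite family `D` of χ₁-cubes with regularity letters on pairwise disjoint regions of `≤ m` plaquettes and `ε″ ≥ 0`;
and for EVERY cutoff `Kc`, every history tower `T` over `cfgOfRecord F N K ·`, every pattern `S`, every level-measure family with `μ 0 = ∏dU`, every
step-kernel family `χ` that READS LABEL SUB-SUMS of the record at every level (`hread`: at level `j`, after the prefix `h`, the pinned kernel sum is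
`Σ_{t ∈ E j h} ω (sq j h) t (U, Ū)` for some old sequence `sq j h` and label set `E j h`) with the level-`0` sets pinning `D` (`hE0`), every carrier family
with `M 0 h = e^{a 0 h}·𝟙_{event}` and `M j h = 1` for `j ≥ 1`, all exponents with `e^{a 0 h}·(m·r)^{#D} ≤ e^{b 0 h}`, `a j h ≤ 0 ≤ b j h` for `j ≥ 1`,
and the (α)-road's displayed rows `hint` (integrability of the history terms at the levels `1 ≤ j < Kc`) and `hρ₀` (`ρ₀` in the good class, so that
`eterm ≥ 0`, `Tower.eterm_nonneg`):
`PointwiseExtraction T S Kc χ M a ∧ LocCondStability T S Kc μ (rhoZeroOfRecord F N K g₀ E₀) M b`.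
So along a key pattern whose key is ROOTED AT STEP 0 the cost–volume sum is `Σ_{j<Kc}(a − b) ≥ (a − b)(0) − Σ_{j≥1} b j` with
`(a − b)(0) = #D·(δ₀g₀⁻²ε″²∕(2N) − Cδ₀ − log m)` available — the free levels may be booked at `a = b = 0`. [folklore] -/
theorem halves_of_record_rootedAtZero :
    ∃ δ₀ : ℝ, 0 < δ₀ ∧ ∃ C : ℝ, 0 ≤ C ∧ ∀ (_hK : 1 ≤ p.K) (g₀ E₀ : ℝ), 4 * N ≤ g₀⁻¹ ^ 2 →
      ∀ (A₁ : ℝ) {ζ : ZetaOfRecord F N ν M}, IsZetaUnity F N ν M ζ → IsZetaAbsLeOne F N ν M ζ →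
        (∀ q g' k' (s : SeqOfRecord F ν M g' q.K k') Pl Ql RS U V', 0 ≤ ζ q g' k' s Pl Ql RS U V') →
      ∀ (s : SeqOfRecord F ν M g p.K 0) (D : Finset (Iχ F ν p g 0)) (R : Iχ F ν p g 0 → Finset (Plaq (F.P p.K) 1))
        (m : ℕ) (ε'' : ℝ), 0 ≤ ε'' → (∀ c ∈ D, (R c).card ≤ m) →
        (∀ c₁ ∈ D, ∀ c₂ ∈ D, c₁ ≠ c₂ → Disjoint (R c₁) (R c₂)) →
        (∀ c ∈ D, ∀ V' : GaugeField (F.P p.K) 1 (SU N),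
          (∀ p' ∈ R c, dist1 (GaugeField.plaqHol V' p') < ε'') → chiFactor F N ν p g 0 c V' = 1) →
      ∀ (Kc : ℕ) {Pat : Type} [DecidableEq Pat] {𝒢 : (j : ℕ) → GoodClass (cfgOfRecord F N p.K j)}
        (T : Tower Pat (fun j => cfgOfRecord F N p.K j) 𝒢) (S : (j : ℕ) → (Fin j → Pat) → Finset Pat)
        (μ : (j : ℕ) → Measure (cfgOfRecord F N p.K j))
        (χ : (j : ℕ) → (Fin j → Pat) → Pat → cfgOfRecord F N p.K j → ℝ)
        (Mc : (j : ℕ) → (Fin j → Pat) → cfgOfRecord F N p.K j → ℝ) (a b : (j : ℕ) → (Fin j → Pat) → ℝ)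
        (sq : (j : ℕ) → (Fin j → Pat) → SeqOfRecord F ν M g p.K j) (E : (j : ℕ) → (Fin j → Pat) → Finset (LbOfRecord F ν p g j)),
        sq 0 = (fun _ => s) →
        (∀ h t, t ∈ E 0 h → D ⊆ t.1) →
        μ 0 = fieldMeasure (F.P p.K) 0 (SU N) →
        (∀ (j : ℕ) (h : Fin j → Pat) (U : cfgOfRecord F N p.K j), ∑ q ∈ T.branch j h ∩ S j h, χ j h q U =
          ∑ t ∈ E j h, ωOfRecord F N ν M p g j A₁ ζ (sq j h) t U ((avOfRecord F N p.K j).avg U)) →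
        (∀ (h : Fin 0 → Pat) (U : cfgOfRecord F N p.K 0), Mc 0 h U = Real.exp (a 0 h) *
          Set.indicator {U : GaugeField (F.P p.K) 0 (SU N) |
            ∀ c ∈ D, ∃ p' ∈ R c, ε'' ≤ dist1 (GaugeField.plaqHol ((avOfRecord F N p.K 0).avg U) p')} (fun _ => (1 : ℝ)) U) →
        (∀ (j : ℕ) (h : Fin j → Pat), 1 ≤ j → Mc j h = fun _ => 1) →
        (∀ h : Fin 0 → Pat, Real.exp (a 0 h) *
          ((m : ℝ) * Real.exp (C * δ₀ - δ₀ * g₀⁻¹ ^ 2 * (ε'' ^ 2 / (2 * (Fintype.card (Fin N) : ℝ))))) ^ D.card ≤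
            Real.exp (b 0 h)) →
        (∀ (j : ℕ) (h : Fin j → Pat), 1 ≤ j → a j h ≤ 0 ∧ 0 ≤ b j h) →
        (∀ (j : ℕ) (h : Fin j → Pat), 1 ≤ j → j < Kc → h ∈ admS T S j →
          Integrable (T.eterm (rhoZeroOfRecord F N p.K g₀ E₀) j h) (μ j)) →
        (𝒢 0).Gd (rhoZeroOfRecord F N p.K g₀ E₀) →
        PointwiseExtraction T S Kc χ Mc a ∧ LocCondStability T S Kc μ (rhoZeroOfRecord F N p.K g₀ E₀) Mc b := by
  obtain ⟨δ₀, hδ₀, C, hC, h⟩ := integral_exp_mul_indicator_rhoZero_le F N ν p g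
  refine ⟨δ₀, hδ₀, C, hC, fun hK g₀ E₀ hg A₁ ζ hζu hζ hζ0 s D R m ε'' hε hm hdisj hreg Kc Pat _ 𝒢 T S μ χ Mc a b sq E hsq hE0 hμ
    hread hM0 hMj hb0 habj hint hρ => ⟨?_, ?_⟩⟩
  · -- half (i) at every level
    intro j gh hj _ U
    rcases Nat.eq_zero_or_pos j with rfl | hjpos
    · -- the root step: module 23's sub-family bound with the indicator carrier
      rw [hread 0 gh U, hM0 gh U, ← mul_assoc, ← Real.exp_add, neg_add_cancel, Real.exp_zero, one_mul, hsq]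
      have h1 := (le_abs_self _).trans
        (abs_sum_ωOfRecord_sub_le_indicator F N ν M p g 0 A₁ hζ hζ0 s D (E 0 gh) (hE0 gh) R ε'' hreg U
          ((avOfRecord F N p.K 0).avg U))
      refine h1.trans (le_of_eq ?_)
      by_cases hU : ∀ c ∈ D, ∃ p' ∈ R c, ε'' ≤ dist1 (GaugeField.plaqHol ((avOfRecord F N p.K 0).avg U) p')
      · rw [Set.indicator_of_mem (show (avOfRecord F N p.K 0).avg U ∈ {V' : GaugeField (F.P p.K) 1 (SU N) |
            ∀ c ∈ D, ∃ p' ∈ R c, ε'' ≤ dist1 (GaugeField.plaqHol V' p')} from hU),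
          Set.indicator_of_mem (show U ∈ {U : GaugeField (F.P p.K) 0 (SU N) |
            ∀ c ∈ D, ∃ p' ∈ R c, ε'' ≤ dist1 (GaugeField.plaqHol ((avOfRecord F N p.K 0).avg U) p')} from hU)]
      · rw [Set.indicator_of_notMem (show (avOfRecord F N p.K 0).avg U ∉ {V' : GaugeField (F.P p.K) 1 (SU N) |
            ∀ c ∈ D, ∃ p' ∈ R c, ε'' ≤ dist1 (GaugeField.plaqHol V' p')} from hU),
          Set.indicator_of_notMem (show U ∉ {U : GaugeField (F.P p.K) 0 (SU N) |
            ∀ c ∈ D, ∃ p' ∈ R c, ε'' ≤ dist1 (GaugeField.plaqHol ((avOfRecord F N p.K 0).avg U) p')} from hU)]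
    · -- a later, free level: the sub-sum is at most `1 = e^{−0}·M`, and `a ≤ 0`
      rw [hread j gh U, hMj j gh hjpos]
      have h1 := sum_ωOfRecord_sub_le_one F N ν M p g j A₁ hζu hζ0 (sq j gh) (E j gh) U ((avOfRecord F N p.K j).avg U)
      rw [neg_zero, Real.exp_zero, one_mul] at h1
      calc ∑ t ∈ E j gh, ωOfRecord F N ν M p g j A₁ ζ (sq j gh) t U ((avOfRecord F N p.K j).avg U) ≤ 1 := h1
        _ ≤ Real.exp (-a j gh) * (fun _ : cfgOfRecord F N p.K j => (1 : ℝ)) U := by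
            rw [mul_one]
            exact Real.one_le_exp (by linarith [(habj j gh hjpos).1])
  · -- half (ii) at every level
    intro j gh hj hadm
    rcases Nat.eq_zero_or_pos j with rfl | hjpos
    · have hMh : Mc 0 gh = fun U => Real.exp (a 0 gh) *
          Set.indicator {U : GaugeField (F.P p.K) 0 (SU N) |
            ∀ c ∈ D, ∃ p' ∈ R c, ε'' ≤ dist1 (GaugeField.plaqHol ((avOfRecord F N p.K 0).avg U) p')} (fun _ => (1 : ℝ)) U :=
        funext (hM0 gh)
      show Integrable (fun y => Mc 0 gh y * rhoZeroOfRecord F N p.K g₀ E₀ y) (μ 0) ∧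
        ∫ y, Mc 0 gh y * rhoZeroOfRecord F N p.K g₀ E₀ y ∂μ 0 ≤
          Real.exp (b 0 gh) * ∫ y, rhoZeroOfRecord F N p.K g₀ E₀ y ∂μ 0
      rw [hMh, hμ]
      obtain ⟨hi, hle⟩ := h hK g₀ E₀ hg D R m ε'' hε hm hdisj (a 0 gh)
      exact ⟨hi, hle.trans (mul_le_mul_of_nonneg_right (hb0 gh)
        (integral_nonneg fun U => (rhoZeroOfRecord_pos F N p.K g₀ E₀ U).le))⟩
    · have hMh : Mc j gh = fun _ => 1 := hMj j gh hjpos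
      have hI := hint j gh hjpos hj hadm
      refine ⟨?_, ?_⟩
      · simpa only [hMh, one_mul] using hI
      · have h1 : ∫ y, Mc j gh y * T.eterm (rhoZeroOfRecord F N p.K g₀ E₀) j gh y ∂μ j =
            ∫ y, T.eterm (rhoZeroOfRecord F N p.K g₀ E₀) j gh y ∂μ j :=
          integral_congr_ae (ae_of_all _ fun y => by simp only [hMh, one_mul])
        rw [h1]
        have hI0 : 0 ≤ ∫ y, T.eterm (rhoZeroOfRecord F N p.K g₀ E₀) j gh y ∂μ j :=
          integral_nonneg fun y => T.eterm_nonneg hρ (fun x => (rhoZeroOfRecord_pos F N p.K g₀ E₀ x).le) j gh y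
        calc ∫ y, T.eterm (rhoZeroOfRecord F N p.K g₀ E₀) j gh y ∂μ j
            = 1 * ∫ y, T.eterm (rhoZeroOfRecord F N p.K g₀ E₀) j gh y ∂μ j := (one_mul _).symm
          _ ≤ Real.exp (b j gh) * ∫ y, T.eterm (rhoZeroOfRecord F N p.K g₀ E₀) j gh y ∂μ j :=
              mul_le_mul_of_nonneg_right (Real.one_le_exp (habj j gh hjpos).2) hI0

/-! ## §3 Sanity: the regularity letter is inhabited in the degenerate threshold regime (an A3 witness, NOT Bałaban's regime) -/

/-- **THE (3.2) FACTOR IS IDENTICALLY ONE WHEN THE TEST THRESHOLD DOMINATES THE REGULARITY THRESHOLD** (`εreg ≤ ε_{k+1}`): on the solvable set the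
local minimal configuration lies in the regularity class `|U(∂p) − 1| < εreg·η²` of the (2.12) problem (n20-d's `plaqSmall_ukBox_of_solvable`), hence
passes the weaker test; off it the factor is `1` by the typing convention.  In Bałaban's regime `ε_{k+1} < εreg` and the letter is [Balaban1985Variational]
Thm 1; this lemma only witnesses that the displayed letter `hreg` is SATISFIABLE at the objects of record. [folklore] -/
theorem chiFactor_eq_one_of_epsreg_le (k : ℕ) (c : Iχ F ν p g k) (hle : ν.εreg ≤ epsOfRecord ν g (k + 1))
    (hδ : 0 < epsOfRecord ν g (k + 1) * (F.P p.K).eta (k + 1) ^ 2) (V' : GaugeField (F.P p.K) (k + 1) (SU N)) :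
    chiFactor F N ν p g k c V' = 1 := by
  unfold chiFactor
  by_cases hs : ∃ U₀, IsMinimizer (avOfRecord F N p.K) {U | PlaqSmall (ν.εreg * (F.P p.K).eta (k + 1) ^ 2) U}
      (Bj ν.M₁ (cubeEnl (F.P p.K) (sideχ F ν p g k) c 4) (k + 1)) (avgFamily (avOfRecord F N p.K) (qsstarGIter0 (k + 1) V')) U₀
  · have hreg := plaqSmall_ukBox_of_solvable (F := F) (N := N) hs
    unfold chiSmall
    rw [if_pos]
    intro q _
    exact (hreg q).trans_le (mul_le_mul_of_nonneg_right hle (sq_nonneg _))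
  · exact chiSmall_ukBox_eq_one_of_not_solvable (F := F) (N := N) _ hδ hs

/-- **THE REGULARITY LETTER IS INHABITED in the degenerate threshold regime** (every region `R`, every `ε″`): an A3 witness for the displayed hypothesis
`hreg` of modules 18–24. [folklore] -/
theorem hreg_of_epsreg_le (k : ℕ) (c : Iχ F ν p g k) (hle : ν.εreg ≤ epsOfRecord ν g (k + 1))
    (hδ : 0 < epsOfRecord ν g (k + 1) * (F.P p.K).eta (k + 1) ^ 2) (R : Finset (Plaq (F.P p.K) (k + 1))) (ε'' : ℝ) :
    ∀ V' : GaugeField (F.P p.K) (k + 1) (SU N),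
      (∀ p' ∈ R, dist1 (GaugeField.plaqHol V' p') < ε'') → chiFactor F N ν p g k c V' = 1 :=
  fun V' _ => chiFactor_eq_one_of_epsreg_le F N ν p g k c hle hδ V'

end Summit.QuantumFields.YangMills.BalabanUVNodes.N20LCSLargeFieldRootedAtZero

end
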